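import Summits.RiemannHypothesis.RiemannHypothesis.Theorems.PfPersistenceAdmissibleClass
import HarnessLib

/-!
# PARITY TRANSFER identities of the truncated (Galerkin) Weil form: edge value ↔ derivative,
# mean ↔ antiderivative (pub-rhpf FAKE SEAT 4, gen 2; helper for item stmt-RiemannHypothesis-19953)

**mechanism/rigidity campaign; no RH claims.**  Everything here is RH-free, sorry-free linear algebra plus two
pointwise trigonometric identities.  Companion text: `run/shared/lean/pub/pub-rhpf/FAKES.md §4.7`.

## The structure

At a window `[-a, a]` (`L = 2a`) the truncated Weil form splits by parity into the EVEN block (Connes' basis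
`ξ_0 = L^{-1/2}`, `ξ_n = (-1)^n (2/L)^{1/2} cos(2πnx/L)`, `PfPersistenceAdmissibleClass.xiEven/thetaEven/evenBlock`)
and the ODD block (`(-1)^n (2/L)^{1/2} sin(2πnx/L)`, correlation functions `thetaOdd` below).  Both blocks are
values `𝒲(θ_{nm})` of ONE linear functional (polar − archimedean − primes; any weight table) on the correlation
functions `θ^±_{nm}`, and the correlation functions satisfy, POINTWISE in the lag `y` and for `n, m ≥ 1`
(`ω_k = 2πk/L`):

* `ω_n · θ⁻_{nm}(y) − θ⁺_{nm}(y) · ω_m = (2/L) · sin(ω_m y)`   (`thetaOdd_displacement`),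
* `θ⁺_{0m}(y) · ω_m = −(√2/L) · sin(ω_m y)`                      (`thetaEven_border`).

(Löwner / Cauchy-like displacement structure of the windowed exponentials.)  Applying `𝒲` gives the abstract
data packaged in `ParityPair`: odd block `M`, even body `P` (modes `1 … N`), even border `b`, corner `q00`,
frequencies `ω`, the vector `φ_m = 𝒲(sin(ω_m ·))`, and constants `κ = 2/L`, `β = √2/L`, with
`ω_i M_{ij} − P_{ij} ω_j = κ φ_j` and `b_j ω_j = −β φ_j`.

## PROVED (for EVERY `ParityPair`, i.e. every weight table, window and truncation rank)

For an even eigenpair `(ε; u0, u)` (`u0` = coefficient of the constant mode = the MEAN channel, `u` = modes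
`1 … N`), with EDGE SUM `E := β u0 + κ Σ_j u_j` (`= (2/L)^{1/2} · θ_u(a)`, the edge value of the profile, cf.
`profile_edge`):

* `transfer_deriv`:      `(M − ε)(ω • u) = E · φ`            — the DERIVATIVE of the even eigenvector misses being
  an odd eigenvector exactly by the edge value;
* `transfer_antideriv`:  `β (ω_i (M (u/ω))_i − ε u_i) = −u0 (β b_i + κ (ε − q00))` — the ANTIDERIVATIVE misses
  exactly by the mean;
* hence `isOddEigen_deriv_of_edgeSum_eq_zero`, `isOddEigen_antideriv_of_mean_eq_zero`: zero edge value or zero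
  mean of an even eigenvector forces `ε ∈ spec(odd block)`;
* `pairing_deriv`: `(μ − ε) ⟨v, ω • u⟩ = E ⟨φ, v⟩` for every odd eigenpair `(μ, v)`;
* `isEvenEigen_deriv_of_phi_orth`: an odd eigenvector with `⟨φ, v⟩ = 0` differentiates to a mean-zero even
  eigenvector;
* `dichotomy`: at a SIMPLE common eigenvalue of the two blocks, EITHER the even eigenvector has zero edge value
  and the odd one is (a multiple of) its derivative (TYPE 1), OR the even eigenvector has zero mean and is the
  derivative of the odd one (TYPE 2);
* `edgeSum_mul_mean_eq_zero_iff`: for a simple even eigenvalue `ε`, `E · u0 = 0 ↔ ε ∈ spec(odd block)`.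

## Why the cell cares (DATA labels; FAKES.md §4.7)

The served field `theta_end_even` is `θ_u(a)` and the orientation `sign_fix` is the sign of the mean, so
`edgeSum_mul_mean_eq_zero_iff` says: (edge value) × (mean) of the even ground state vanishes EXACTLY at the
windows where the even ground level meets the odd spectrum.  DERIVED (continuity in `a`, fixed `N`): while the
even ground level has met only the odd GROUND level, `sign(θ_u(a)·mean) = sign(ε₁^odd − ε₁^even)` — the
EDGE–MEAN SIGN LAW, DATA 11 213 / 11 222 robust served records over 14 families (9 exceptions: states with 13–50
sign changes where higher odd levels intervene); both crossing types occur (type 1: edge value → 0, ε^even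
stationary; type 2: mean → 0, ε^odd stationary); type-1 coincidence `a_edge = a_×` bisected to `1e-10` at
`N = 200` (jobs j056477, j056885).  No statement about `ζ` beyond DATA is made here.

References: K. Löwner, Math. Z. 38 (1934) 177–216 (Löwner matrices); T. Kailath, A. H. Sayed, SIAM Rev. 37
(1995) 297–386 (displacement structure); A. Connes, C. Consani, arXiv:2106.01715, Lemma 2.6 (`θ_{nm}`).
-/

noncomputable section

open Matrix Finset Real

namespace Summit.RiemannHypothesis.RiemannHypothesis.Theorems.PfPersistenceParityTransfer

open Summit.RiemannHypothesis.RiemannHypothesis.Theorems.PfPersistence (thetaEven xiEven profile)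

/-! ## §1 Parity pairs -/

/-- A PARITY PAIR of rank `N`: the odd block `M`, the even block split as corner `q00`, border `b` and body `P`
(modes `1 … N`), frequencies `ω`, the sine-transform vector `φ` and constants `κ, β`, subject to the DISPLACEMENT
relation `ω_i M_{ij} − P_{ij} ω_j = κ φ_j`, the BORDER relation `b_j ω_j = −β φ_j`, symmetry and
non-degeneracy (`ω_j ≠ 0`, `β ≠ 0`).  Every truncated Weil form at every window is one (`κ = 2/L`, `β = √2/L`,
`thetaOdd_displacement`, `thetaEven_border`). [folklore] -/
structure ParityPair (N : ℕ) where
  /-- even corner entry `(0,0)` -/ q00 : ℝ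
  /-- even border `(0, j+1)` -/ b : Fin N → ℝ
  /-- even body `(i+1, j+1)` -/ P : Matrix (Fin N) (Fin N) ℝ
  /-- odd block -/ M : Matrix (Fin N) (Fin N) ℝ
  /-- frequencies `ω_j = 2π(j+1)/L` -/ ω : Fin N → ℝ
  /-- `φ_j = 𝒲(sin(ω_j ·))` -/ φ : Fin N → ℝ
  /-- displacement constant (`2/L`) -/ κ : ℝ
  /-- border constant (`√2/L`) -/ β : ℝ
  /-- the even body is symmetric -/ P_symm : P.IsSymm
  /-- the odd block is symmetric -/ M_symm : M.IsSymm
  /-- DISPLACEMENT relation -/ displacement : ∀ i j, ω i * M i j - P i j * ω j = κ * φ j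
  /-- BORDER relation -/ border : ∀ j, b j * ω j = -(β * φ j)
  /-- frequencies are non-zero -/ ω_ne : ∀ j, ω j ≠ 0
  /-- border constant is non-zero -/ β_ne : β ≠ 0

namespace ParityPair

variable {N : ℕ} (D : ParityPair N)

/-- `(ε; u0, u)` is an EVEN EIGENPAIR: the bordered even block `[[q00, bᵀ], [b, P]]` has eigenvector `(u0, u)`
with eigenvalue `ε`. [folklore] -/
def IsEvenEigen (ε u0 : ℝ) (u : Fin N → ℝ) : Prop :=
  D.q00 * u0 + D.b ⬝ᵥ u = ε * u0 ∧ ∀ i, u0 * D.b i + (D.P *ᵥ u) i = ε * u i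

/-- `(μ, v)` is an ODD EIGENPAIR: `M v = μ v`. [folklore] -/
def IsOddEigen (μ : ℝ) (v : Fin N → ℝ) : Prop := ∀ i, (D.M *ᵥ v) i = μ * v i

/-- the EDGE SUM `β u0 + κ Σ_j u_j` (`= (2/L)^{1/2} θ_u(a)`, `profile_edge`). [folklore] -/
def edgeSum (u0 : ℝ) (u : Fin N → ℝ) : ℝ := D.β * u0 + D.κ * ∑ j, u j

/-- coefficientwise DERIVATIVE `(ω • u)_j = ω_j u_j` (cosine modes ↦ sine modes). [folklore] -/
def deriv (u : Fin N → ℝ) : Fin N → ℝ := fun j => D.ω j * u j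

/-- coefficientwise ANTIDERIVATIVE `u_j / ω_j`. [folklore] -/
def antideriv (u : Fin N → ℝ) : Fin N → ℝ := fun j => u j / D.ω j

/-- PROVED: the derivative of a non-zero coefficient vector is non-zero. [folklore] -/
theorem deriv_ne_zero {u : Fin N → ℝ} (hu : u ≠ 0) : D.deriv u ≠ 0 := by
  intro h
  apply hu
  funext j
  have hj := congrFun h j
  simp only [deriv, Pi.zero_apply] at hj
  exact (mul_eq_zero.1 hj).resolve_left (D.ω_ne j)

/-- PROVED: the antiderivative of a non-zero coefficient vector is non-zero. [folklore] -/
theorem antideriv_ne_zero {u : Fin N → ℝ} (hu : u ≠ 0) : D.antideriv u ≠ 0 := by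
  intro h
  apply hu
  funext j
  have hj := congrFun h j
  simp only [antideriv, Pi.zero_apply, div_eq_zero_iff] at hj
  exact hj.resolve_right (D.ω_ne j)

/-! ## §2 The two transfer identities -/

/-- **PROVED (TRANSFER BY DERIVATIVE).** For an even eigenpair `(ε; u0, u)`:
`(M (ω • u))_i − ε ω_i u_i = (β u0 + κ Σ u) φ_i` — the derivative of the even eigenvector fails to be an odd
eigenvector with the same eigenvalue exactly by the EDGE SUM times `φ`. [folklore] -/
theorem transfer_deriv {ε u0 : ℝ} {u : Fin N → ℝ} (h : D.IsEvenEigen ε u0 u) (i : Fin N) :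
    (D.M *ᵥ D.deriv u) i - ε * D.deriv u i = D.edgeSum u0 u * D.φ i := by
  have key : ∀ j, D.M i j * (D.ω j * u j) = D.ω i * (D.P i j * u j) + D.κ * D.φ i * u j := by
    intro j
    have hd := D.displacement j i
    rw [D.M_symm.apply i j, D.P_symm.apply i j] at hd
    linear_combination u j * hd
  have h2 : ∑ j, D.P i j * u j = ε * u i - u0 * D.b i := by
    have := h.2 i
    simp only [Matrix.mulVec, dotProduct] at this
    linarith
  have hb := D.border i
  simp only [Matrix.mulVec, dotProduct, deriv, edgeSum]
  rw [Finset.sum_congr rfl fun j _ => key j, Finset.sum_add_distrib, ← Finset.mul_sum, ← Finset.mul_sum, h2]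
  linear_combination (-u0) * hb

/-- **PROVED (TRANSFER BY ANTIDERIVATIVE).** For an even eigenpair `(ε; u0, u)`:
`β (ω_i (M (u/ω))_i − ε u_i) = −u0 (β b_i + κ (ε − q00))` — the antiderivative of the even eigenvector fails to
be an odd eigenvector with the same eigenvalue exactly by the MEAN `u0`. [folklore] -/
theorem transfer_antideriv {ε u0 : ℝ} {u : Fin N → ℝ} (h : D.IsEvenEigen ε u0 u) (i : Fin N) :
    D.β * (D.ω i * (D.M *ᵥ D.antideriv u) i - ε * u i) = -(u0 * (D.β * D.b i + D.κ * (ε - D.q00))) := by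
  have key : ∀ j, D.β * (D.ω i * (D.M i j * (u j / D.ω j))) = D.β * (D.P i j * u j) - D.κ * (D.b j * u j) := by
    intro j
    have hd := D.displacement i j
    have hb := D.border j
    have hinv : D.ω j * (D.ω j)⁻¹ = 1 := mul_inv_cancel₀ (D.ω_ne j)
    rw [div_eq_mul_inv]
    linear_combination (D.β * u j * (D.ω j)⁻¹) * hd + (D.κ * u j * (D.ω j)⁻¹) * hb +
      (D.β * D.P i j * u j - D.κ * D.b j * u j) * hinv
  have h1 : ∑ j, D.b j * u j = ε * u0 - D.q00 * u0 := by
    have := h.1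
    simp only [dotProduct] at this
    linarith
  have h2 : ∑ j, D.P i j * u j = ε * u i - u0 * D.b i := by
    have := h.2 i
    simp only [Matrix.mulVec, dotProduct] at this
    linarith
  simp only [Matrix.mulVec, dotProduct, antideriv]
  rw [mul_sub, Finset.mul_sum, Finset.mul_sum, Finset.sum_congr rfl fun j _ => key j, Finset.sum_sub_distrib,
    ← Finset.mul_sum, ← Finset.mul_sum, h2, h1]
  ring

/-- **PROVED.** Zero edge value ⇒ the derivative `ω • u` is an odd eigenvector with the same eigenvalue. [folklore] -/
theorem isOddEigen_deriv_of_edgeSum_eq_zero {ε u0 : ℝ} {u : Fin N → ℝ} (h : D.IsEvenEigen ε u0 u)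
    (h0 : D.edgeSum u0 u = 0) : D.IsOddEigen ε (D.deriv u) := by
  intro i
  have := D.transfer_deriv h i
  rw [h0, zero_mul, sub_eq_zero] at this
  exact this

/-- **PROVED.** Zero mean ⇒ the antiderivative `u/ω` is an odd eigenvector with the same eigenvalue. [folklore] -/
theorem isOddEigen_antideriv_of_mean_eq_zero {ε u0 : ℝ} {u : Fin N → ℝ} (h : D.IsEvenEigen ε u0 u)
    (h0 : u0 = 0) : D.IsOddEigen ε (D.antideriv u) := by
  intro i
  have ht := D.transfer_antideriv h i
  rw [h0, zero_mul, neg_zero] at ht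
  have h' : D.ω i * (D.M *ᵥ D.antideriv u) i - ε * u i = 0 := by
    exact (mul_eq_zero.1 ht).resolve_left D.β_ne
  have hω := D.ω_ne i
  show (D.M *ᵥ D.antideriv u) i = ε * (u i / D.ω i)
  rw [show ε * (u i / D.ω i) = ε * u i / D.ω i by ring, eq_div_iff hω]
  linear_combination h'

/-! ## §3 Pairing with odd eigenvectors; the dichotomy at a crossing -/

/-- PROVED: for a symmetric odd block, `⟨v, M w⟩ = μ ⟨v, w⟩` when `M v = μ v`. [folklore] -/
theorem dotProduct_mulVec_of_isOddEigen {μ : ℝ} {v : Fin N → ℝ} (hv : D.IsOddEigen μ v) (w : Fin N → ℝ) :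
    v ⬝ᵥ (D.M *ᵥ w) = μ * (v ⬝ᵥ w) := by
  have hv' : ∀ j, ∑ i, D.M j i * v i = μ * v j := fun j => by
    have := hv j
    simpa [Matrix.mulVec, dotProduct] using this
  simp only [dotProduct, Matrix.mulVec]
  calc ∑ i, v i * ∑ j, D.M i j * w j = ∑ i, ∑ j, v i * (D.M i j * w j) := by
        simp only [Finset.mul_sum]
    _ = ∑ j, ∑ i, v i * (D.M i j * w j) := Finset.sum_comm
    _ = ∑ j, w j * ∑ i, D.M j i * v i := by
        refine Finset.sum_congr rfl fun j _ => ?_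
        rw [Finset.mul_sum]
        refine Finset.sum_congr rfl fun i _ => ?_
        rw [D.M_symm.apply i j]
        ring
    _ = ∑ j, w j * (μ * v j) := by simp only [hv']
    _ = μ * ∑ i, v i * w i := by
        rw [Finset.mul_sum]
        exact Finset.sum_congr rfl fun j _ => by ring

/-- **PROVED (PAIRING IDENTITY).** For an even eigenpair `(ε; u0, u)` and an odd eigenpair `(μ, v)`:
`(μ − ε) ⟨v, ω • u⟩ = (β u0 + κ Σ u) ⟨φ, v⟩`.  At a crossing `μ = ε` the right-hand side vanishes. [folklore] -/
theorem pairing_deriv {ε u0 μ : ℝ} {u v : Fin N → ℝ} (hu : D.IsEvenEigen ε u0 u) (hv : D.IsOddEigen μ v) :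
    (μ - ε) * (v ⬝ᵥ D.deriv u) = D.edgeSum u0 u * (D.φ ⬝ᵥ v) := by
  have h1 : v ⬝ᵥ (D.M *ᵥ D.deriv u) = μ * (v ⬝ᵥ D.deriv u) := D.dotProduct_mulVec_of_isOddEigen hv _
  have h2 : v ⬝ᵥ (D.M *ᵥ D.deriv u) - ε * (v ⬝ᵥ D.deriv u) = D.edgeSum u0 u * (D.φ ⬝ᵥ v) := by
    simp only [dotProduct]
    rw [Finset.mul_sum, ← Finset.sum_sub_distrib, Finset.mul_sum]
    refine Finset.sum_congr rfl fun i _ => ?_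
    have := D.transfer_deriv hu i
    linear_combination v i * this
  linear_combination h2 - h1

/-- **PROVED.** An odd eigenpair `(μ, v)` with `⟨φ, v⟩ = 0` differentiates to a MEAN-ZERO even eigenpair
`(μ; 0, ω • v)`. [folklore] -/
theorem isEvenEigen_deriv_of_phi_orth {μ : ℝ} {v : Fin N → ℝ} (hv : D.IsOddEigen μ v) (hφ : D.φ ⬝ᵥ v = 0) :
    D.IsEvenEigen μ 0 (D.deriv v) := by
  simp only [dotProduct] at hφ
  have hv' : ∀ i, ∑ j, D.M i j * v j = μ * v i := fun i => by
    have := hv i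
    simpa [Matrix.mulVec, dotProduct] using this
  constructor
  · simp only [dotProduct, deriv, mul_zero, zero_add]
    calc ∑ j, D.b j * (D.ω j * v j) = ∑ j, -D.β * (D.φ j * v j) :=
          Finset.sum_congr rfl fun j _ => by
            have := D.border j
            linear_combination v j * this
      _ = 0 := by rw [← Finset.mul_sum, hφ, mul_zero]
  · intro i
    simp only [zero_mul, zero_add, Matrix.mulVec, dotProduct, deriv]
    calc ∑ j, D.P i j * (D.ω j * v j) = ∑ j, (D.ω i * (D.M i j * v j) - D.κ * (D.φ j * v j)) :=
          Finset.sum_congr rfl fun j _ => by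
            have := D.displacement i j
            linear_combination (-(v j)) * this
      _ = D.ω i * ∑ j, D.M i j * v j - D.κ * ∑ j, D.φ j * v j := by
          rw [Finset.sum_sub_distrib, Finset.mul_sum, Finset.mul_sum]
      _ = μ * (D.ω i * v i) := by rw [hv', hφ]; ring

/-- **PROVED (THE DICHOTOMY AT A PARITY CROSSING).** If `ε` is a SIMPLE eigenvalue of the even block
(eigenvector `(u0, u)`) and of the odd block (eigenvector `v`), then EITHER the even eigenvector has zero edge
sum and its derivative is a multiple of `v` (TYPE 1), OR it has zero mean and is a multiple of the derivative of
`v` (TYPE 2). [folklore] -/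
theorem dichotomy {ε u0 : ℝ} {u v : Fin N → ℝ} (hu : D.IsEvenEigen ε u0 u) (hv : D.IsOddEigen ε v)
    (hv0 : v ≠ 0) (hodd : ∀ w, D.IsOddEigen ε w → ∃ c : ℝ, w = c • v)
    (heven : ∀ (u0' : ℝ) (u' : Fin N → ℝ), D.IsEvenEigen ε u0' u' → ∃ c : ℝ, u0' = c * u0 ∧ u' = c • u) :
    (D.edgeSum u0 u = 0 ∧ ∃ c : ℝ, D.deriv u = c • v) ∨ (u0 = 0 ∧ ∃ c : ℝ, u = c • D.deriv v) := by
  have hp := D.pairing_deriv hu hv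
  rw [sub_self, zero_mul] at hp
  rcases mul_eq_zero.1 hp.symm with h0 | hφ
  · exact Or.inl ⟨h0, hodd _ (D.isOddEigen_deriv_of_edgeSum_eq_zero hu h0)⟩
  · obtain ⟨c, hc0, hcu⟩ := heven 0 (D.deriv v) (D.isEvenEigen_deriv_of_phi_orth hv hφ)
    have hc : c ≠ 0 := by
      rintro rfl
      simp only [zero_smul] at hcu
      exact D.deriv_ne_zero hv0 hcu
    refine Or.inr ⟨?_, c⁻¹, ?_⟩
    · exact (mul_eq_zero.1 hc0.symm).resolve_left hc
    · rw [hcu, smul_smul, inv_mul_cancel₀ hc, one_smul]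

/-- **PROVED (ZERO SET OF EDGE × MEAN).** If `ε` is a SIMPLE eigenvalue of the even block with eigenvector
`(u0, u)`, `u ≠ 0`, then `(β u0 + κ Σ u) · u0 = 0` — zero edge value OR zero mean — holds IF AND ONLY IF `ε` is
an eigenvalue of the odd block.  (Only the direction `←` uses simplicity.) [folklore] -/
theorem edgeSum_mul_mean_eq_zero_iff {ε u0 : ℝ} {u : Fin N → ℝ} (hu : D.IsEvenEigen ε u0 u) (hu0 : u ≠ 0)
    (heven : ∀ (u0' : ℝ) (u' : Fin N → ℝ), D.IsEvenEigen ε u0' u' → ∃ c : ℝ, u0' = c * u0 ∧ u' = c • u) :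
    D.edgeSum u0 u * u0 = 0 ↔ ∃ w : Fin N → ℝ, w ≠ 0 ∧ D.IsOddEigen ε w := by
  constructor
  · intro h
    rcases mul_eq_zero.1 h with h0 | h0
    · exact ⟨_, D.deriv_ne_zero hu0, D.isOddEigen_deriv_of_edgeSum_eq_zero hu h0⟩
    · exact ⟨_, D.antideriv_ne_zero hu0, D.isOddEigen_antideriv_of_mean_eq_zero hu h0⟩
  · rintro ⟨w, hw0, hw⟩
    have hp := D.pairing_deriv hu hw
    rw [sub_self, zero_mul] at hp
    rcases mul_eq_zero.1 hp.symm with h0 | hφ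
    · rw [h0, zero_mul]
    · obtain ⟨c, hc0, hcu⟩ := heven 0 (D.deriv w) (D.isEvenEigen_deriv_of_phi_orth hw hφ)
      have hc : c ≠ 0 := by
        rintro rfl
        simp only [zero_smul] at hcu
        exact D.deriv_ne_zero hw0 hcu
      rw [(mul_eq_zero.1 hc0.symm).resolve_left hc, mul_zero]

/-- **PROVED (one-way transfer without simplicity).** Zero edge value or zero mean of an even eigenvector with
eigenvalue `ε` and `u ≠ 0` puts `ε` in the odd spectrum; in particular (taking `ε` = the even ground level) the
odd ground level is then `≤ ε`. [folklore] -/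
theorem exists_isOddEigen_of_edgeSum_mul_mean_eq_zero {ε u0 : ℝ} {u : Fin N → ℝ} (hu : D.IsEvenEigen ε u0 u)
    (hu0 : u ≠ 0) (h : D.edgeSum u0 u * u0 = 0) : ∃ w : Fin N → ℝ, w ≠ 0 ∧ D.IsOddEigen ε w := by
  rcases mul_eq_zero.1 h with h0 | h0
  · exact ⟨_, D.deriv_ne_zero hu0, D.isOddEigen_deriv_of_edgeSum_eq_zero hu h0⟩
  · exact ⟨_, D.antideriv_ne_zero hu0, D.isOddEigen_antideriv_of_mean_eq_zero hu h0⟩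

end ParityPair

/-! ## §4 The displacement structure of Connes' correlation functions (pointwise in the lag) -/

/-- `θ^odd_{nm}(y)` for `n, m ≥ 1`: the correlation function `∫ ξ⁻_n(x) ξ⁻_m(x + y) dx` of the ODD window basis
`ξ⁻_n = (-1)^n (2/L)^{1/2} sin(2πnx/L)` on `0 ≤ y ≤ L` (closed form; companion of `thetaEven`). [folklore] -/
def thetaOdd (L : ℝ) (n m : ℕ) (y : ℝ) : ℝ :=
  if n = m then (L - y) / L * Real.cos (2 * π * n * y / L) + Real.sin (2 * π * n * y / L) / (2 * π * n)
  else ((m : ℝ) * Real.sin (2 * π * n * y / L) - (n : ℝ) * Real.sin (2 * π * m * y / L)) /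
    (π * ((m : ℝ) ^ 2 - (n : ℝ) ^ 2))

/-- PROVED: `m² − n² ≠ 0` in `ℝ` for distinct naturals with `m ≠ 0`. [folklore] -/
theorem cast_sq_sub_sq_ne_zero {n m : ℕ} (hnm : n ≠ m) (hm : m ≠ 0) : ((m : ℝ) ^ 2 - (n : ℝ) ^ 2) ≠ 0 := by
  rw [sq_sub_sq]
  refine mul_ne_zero ?_ (sub_ne_zero.2 (by exact_mod_cast (Ne.symm hnm)))
  have hm' : (0 : ℝ) < m := by exact_mod_cast Nat.pos_of_ne_zero hm
  have hn' : (0 : ℝ) ≤ n := Nat.cast_nonneg n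
  exact ne_of_gt (by linarith)

/-- **PROVED (DISPLACEMENT IDENTITY, pointwise).** For `n, m ≥ 1`, `L ≠ 0` and every lag `y`:
`ω_n θ⁻_{nm}(y) − θ⁺_{nm}(y) ω_m = (2/L) sin(ω_m y)`, `ω_k = 2πk/L`. [folklore] -/
theorem thetaOdd_displacement {L : ℝ} (hL : L ≠ 0) {n m : ℕ} (hn : n ≠ 0) (hm : m ≠ 0) (y : ℝ) :
    (2 * π * n / L) * thetaOdd L n m y - thetaEven L n m y * (2 * π * m / L) =
      2 / L * Real.sin (2 * π * m * y / L) := by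
  have hπ : (π : ℝ) ≠ 0 := Real.pi_ne_zero
  have hn' : (n : ℝ) ≠ 0 := by exact_mod_cast hn
  have hm' : (m : ℝ) ≠ 0 := by exact_mod_cast hm
  unfold thetaOdd thetaEven
  by_cases hnm : n = m
  · subst hnm
    simp only [hn, and_self, if_false, if_true]
    field_simp
    ring
  · have hd := cast_sq_sub_sq_ne_zero hnm hm
    simp only [hn, hm, hnm, and_self, if_false]
    field_simp
    ring

/-- **PROVED (BORDER IDENTITY, pointwise).** For `m ≥ 1`, `L ≠ 0` and every lag `y`:
`θ⁺_{0m}(y) ω_m = −(√2/L) sin(ω_m y)`. [folklore] -/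
theorem thetaEven_border {L : ℝ} (hL : L ≠ 0) {m : ℕ} (hm : m ≠ 0) (y : ℝ) :
    thetaEven L 0 m y * (2 * π * m / L) = -(Real.sqrt 2 / L * Real.sin (2 * π * m * y / L)) := by
  have hπ : (π : ℝ) ≠ 0 := Real.pi_ne_zero
  have hm' : (m : ℝ) ≠ 0 := by exact_mod_cast hm
  have h2 : Real.sqrt 2 ≠ 0 := by positivity
  have h22 : Real.sqrt 2 * Real.sqrt 2 = 2 := Real.mul_self_sqrt (by norm_num)
  have hLL : L / L = 1 := div_self hL
  unfold thetaEven
  simp only [hm, true_and, if_false, if_true, Nat.cast_zero]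
  rw [div_mul_div_comm, div_eq_iff (by positivity)]
  linear_combination (Real.sin (2 * π * m * y / L) * π * m * (L / L)) * h22 +
    (2 * π * m * Real.sin (2 * π * m * y / L)) * hLL

/-! ## §5 The edge value of a profile -/

/-- **PROVED.** The EDGE VALUE of the profile of a coefficient vector: `θ_u(L/2) = (u_0 + √2 Σ_{j≥1} u_j)/√L`
(so the served `theta_end_even` is `(L/2)^{1/2}` times the edge sum `β u_0 + κ Σ_{j ≥ 1} u_j` of §1 with
`β = √2/L`, `κ = 2/L`). [folklore] -/
theorem profile_edge {L : ℝ} (hL : 0 < L) {N : ℕ} (u : Fin (N + 1) → ℝ) :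
    profile L u (L / 2) = (u 0 + Real.sqrt 2 * ∑ j : Fin N, u j.succ) / Real.sqrt L := by
  have hL' : L ≠ 0 := hL.ne'
  have hxi0 : xiEven L ((0 : Fin (N + 1)) : ℕ) (L / 2) = 1 / Real.sqrt L := by
    simp [xiEven]
  have hxis : ∀ j : Fin N, xiEven L ((j.succ : Fin (N + 1)) : ℕ) (L / 2) = Real.sqrt 2 / Real.sqrt L := by
    intro j
    have hne : ((j.succ : Fin (N + 1)) : ℕ) ≠ 0 := by simp [Fin.val_succ]
    simp only [xiEven, hne, if_false]
    have harg : 2 * π * (((j.succ : Fin (N + 1)) : ℕ) : ℝ) * (L / 2) / L =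
        (((j.succ : Fin (N + 1)) : ℕ) : ℝ) * π := by
      rw [div_eq_iff hL']
      ring
    rw [harg, Real.cos_nat_mul_pi, Real.sqrt_div (by norm_num : (0 : ℝ) ≤ 2)]
    rw [mul_comm ((-1 : ℝ) ^ _) _, mul_assoc, ← mul_pow, show (-1 : ℝ) * -1 = 1 by norm_num, one_pow, mul_one]
  unfold profile
  rw [Fin.sum_univ_succ, hxi0, Finset.sum_congr rfl fun j _ => by rw [hxis j]]
  rw [← Finset.sum_mul]
  field_simp

end Summit.RiemannHypothesis.RiemannHypothesis.Theorems.PfPersistenceParityTransfer
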